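/-
Copyright (c) 2026 the pub-hodgecm-mathlib formalisation cell (harness21).  Prover seat hodgecm-mathlib-K2E5-p01 (g2),
Track B «K2-LIT» ∕ h413, engine E5 «TamagawaUnitary», unit G «ZETA ∕ DESCENT», DEFS LEAF (companion of `K2E5QuatThetaBounds`,
K2E5-plan (g2) RULING (A)(1) 2026-09-03T23:30:59Z): LEFT MULTIPLICATION BY A UNIT OF `D_{h,𝔸}` AND THE CENTRAL RAY, IN THE
COORDINATES `quatCoord e`.  2026-09-04.
-/
import Summits.HodgeConjecture.HodgeConjecture.Theorems.K2E5QuatAdelicModuleOneDefs       -- ★ #3j-bis (K2E5-p03): `baseScalar`, `quatModuleSection` (θ); brings ★ #3i, ★ `posRealIdele`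
import Summits.HodgeConjecture.HodgeConjecture.Theorems.K2E5QuatAdelicCoordinates       -- ★ (K2E5-p16): `quatCoordEquiv : 𝔸⁺⁴ ≃ₜ+ D_{h,𝔸}`; brings ★ #3g `quatCoord`, `quatBasis`
import HarnessLib

/-!
# K2 ∕ E5 «TamagawaUnitary», unit G — DEFS LEAF `K2E5QuatLeftMulDefs`: left multiplication by a unit of `D_{h,𝔸}` as a continuous family of
# matrices `M(y) ∈ GL₄(𝔸_K)` in the coordinates `quatCoord e`, and the central ray `θ_τ` in coordinates

Cell `pub/hodgecm-mathlib` (D-0151), Track B, item h413 = `stmt-HodgeConjecture-24833`; lane `--kind definition --supports stmt-HodgeConjecture-24833 --as helper`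
(DEFS BEFORE SIGS: the two definitions `leftMulLin`, `leftMulGL` with their API; consumer = this seat's `Theorems/K2E5QuatThetaBounds.lean`, the theta-sum bounds
for K2E5-p07's ★ `K2E5QuatZetaAbsConvOfThetaBounds`, hence sockets G3 ∕ G11 of unit G).  No `sorry`, axioms ⊆ the trio, no `instance`, no `notation`.

THE MATHEMATICS [VignerasLNM800, Ch. III §1 (`X_A = X ⊗_K K_A` on a `K`-basis); WeilBNT1967, Ch. VII §5].  Let `h` be a non-degenerate hermitian plane over the CM
field `L`, `K = L⁺`, `D_h ⊂ M₂(L)` its quaternion algebra (★ #3d) with `K`-basis `e = quatBasis` (★ #3g) and coordinates `quatCoord e : 𝔸_K⁴ ≃ D_{h,𝔸}`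
(★ `quatCoordEquiv`).  For a unit `y ∈ (D_h ⊗ 𝔸)^× = quatAdelicUnits`, LEFT MULTIPLICATION `x ↦ y x` preserves `D_{h,𝔸}` (a subring) and is `𝔸_K`-LINEAR
(the `𝔸_K`-action is by the central scalars `c ⊗ 1`, ★ `quatCoord_smul`), so in coordinates it is an `𝔸_K`-linear automorphism `T_y` of `𝔸_K⁴`
(`leftMulLin`), i.e. — in the ROW convention `a ᵥ* M` of the tree's theta lemmas — a matrix `M(y) = (LinearMap.toMatrix' T_y)ᵀ ∈ GL₄(𝔸_K)` with inverse `M(y⁻¹)`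
(`leftMulGL`): **`y · quatCoord e (a) = quatCoord e (a ᵥ* M(y))`** (`coe_mul_quatCoord_eq`), and `y ↦ M(y)` is CONTINUOUS (`continuous_leftMulGL`: the entries of
`M(y)` and of `M(y)⁻¹` are coordinates of `quatCoordEquiv⁻¹ (y · (eⱼ ⊗ 1))`, Mathlib `Units.continuous_iff`).  The central section `θ_τ = quatModuleSection τ`
(★ #3j-bis; module `τ`) is the scalar idèle `posRealIdele K (τ^{1∕4d})` (`d = [K : ℚ]`), so `θ_τ · quatCoord e (a) = quatCoord e (posRealIdele K (τ^{1∕4d}) • a)`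
(`coe_quatModuleSection_mul_quatCoord`) and `(c • a) ᵥ* M = a ᵥ* (M · posRealScalar 4 K s)` for `c = posRealIdele K s` (`smul_vecMul_eq_vecMul_mul_posRealScalar`).

HONEST LABEL.  HC_CM is proved only modulo the 7 printed citations (2 remaining named inputs: hLiu418 = `stmt-HodgeConjecture-24832`, h413 =
`stmt-HodgeConjecture-24833`) until rung 0 closes; this file NAMES two linear-algebra objects and asserts nothing toward any count.

## References
* [VignerasLNM800] M.-F. Vignéras, *Arithmétique des algèbres de quaternions*, LNM 800 (1980), Ch. III §1.
* [WeilBNT1967] A. Weil, *Basic Number Theory* (1967), Ch. IV §4 (the module, the split component), Ch. VII §5.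
-/

set_option autoImplicit false
-- the mandated namespace repeats the single-problem summit's segment (`HodgeConjecture.HodgeConjecture`)
set_option linter.dupNamespace false

noncomputable section

namespace Summit.HodgeConjecture.HodgeConjecture.Cruxes.H413.K2E5QuatLeftMul

open NumberField IsDedekindDomain MeasureTheory Filter Topology Set
open scoped Matrix MatrixGroups NNReal ENNReal
open Literature.NumberTheory.Automorphic
open Summit.HodgeConjecture.HodgeConjecture.Cruxes.H413.K2E5QuatAdelicMatrixModel
open Summit.HodgeConjecture.HodgeConjecture.Cruxes.H413.K2E5QuatZeta
open Summit.HodgeConjecture.HodgeConjecture.Cruxes.H413.K2E5QuatAdelicCoordinates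
open Summit.HodgeConjecture.HodgeConjecture.Cruxes.H413.K2E5QuatAdelicNrd
open Summit.HodgeConjecture.HodgeConjecture.Cruxes.H413.K2E5QuatAdelicModuleOne

variable (L : Type) [Field L] [NumberField L] [IsCMField L] {Ha : Matrix (Fin 2) (Fin 2) L}
  (hHa : (Ha.map (cmConjRingHom L)).transpose = Ha) (hdet : Ha.det ≠ 0)

/-! ## §1 Left multiplication by a unit of `D_{h,𝔸}` in the coordinates `quatCoord e`: a continuous family of matrices `M(y) ∈ GL₄(𝔸_K)` -/

section LeftMul

/-- The product of a unit `y ∈ (D_h ⊗ 𝔸)^×` and a point of `D_{h,𝔸}` lies in `D_{h,𝔸}` (a subring). [cite: VignerasLNM800, Ch. III §1] -/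
theorem coe_mul_quatCoord_mem (y : ↥(quatAdelicUnits L Ha)) (a : Fin 4 → AdeleRing (𝓞 ↥(maximalRealSubfield L)) ↥(maximalRealSubfield L)) :
    ((y : GL (Fin 2) (AdeleRing (𝓞 L) L)) : Matrix (Fin 2) (Fin 2) (AdeleRing (𝓞 L) L)) *
        quatCoord L (fun i => ((quatBasis L Ha hHa hdet i : ↥(quatRatSubalgebra L Ha)) : Matrix (Fin 2) (Fin 2) L)) a ∈ quatAdelic L Ha :=
  (quatAdelic L Ha).mul_mem ((mem_quatAdelicUnits_iff L Ha _).1 y.2) (quatCoord_mem_quatAdelic L Ha (coe_quatBasis_mem L Ha hHa hdet) a)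

/-- **Left multiplication by `y` in coordinates, as an `𝔸_K`-LINEAR map `T_y` of `𝔸_K⁴`**: `T_y a := quatCoordEquiv⁻¹ (y · quatCoordEquiv a)` — additive because
`quatCoordEquiv` is, `𝔸_K`-homogeneous because the `𝔸_K`-action on `D_{h,𝔸}` is by the central scalars `c ⊗ 1` (★ `quatCoord_smul`). [cite: VignerasLNM800, Ch. III §1] -/
def leftMulLin (y : ↥(quatAdelicUnits L Ha)) :
    (Fin 4 → AdeleRing (𝓞 ↥(maximalRealSubfield L)) ↥(maximalRealSubfield L)) →ₗ[AdeleRing (𝓞 ↥(maximalRealSubfield L)) ↥(maximalRealSubfield L)]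
      (Fin 4 → AdeleRing (𝓞 ↥(maximalRealSubfield L)) ↥(maximalRealSubfield L)) where
  toFun a := (quatCoordEquiv L hHa hdet).symm
    ⟨((y : GL (Fin 2) (AdeleRing (𝓞 L) L)) : Matrix (Fin 2) (Fin 2) (AdeleRing (𝓞 L) L)) *
        quatCoord L (fun i => ((quatBasis L Ha hHa hdet i : ↥(quatRatSubalgebra L Ha)) : Matrix (Fin 2) (Fin 2) L)) a,
      coe_mul_quatCoord_mem L hHa hdet y a⟩
  map_add' a b := by
    rw [← map_add]
    congr 1
    exact Subtype.ext (by simp only [map_add, Matrix.mul_add, Subring.coe_add])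
  map_smul' c a := by
    apply (quatCoordEquiv L hHa hdet).injective
    rw [ContinuousAddEquiv.apply_symm_apply, RingHom.id_apply]
    refine Subtype.ext ?_
    change ((y : GL (Fin 2) (AdeleRing (𝓞 L) L)) : Matrix (Fin 2) (Fin 2) (AdeleRing (𝓞 L) L)) *
        quatCoord L _ (c • a) = quatCoord L _ (c • (quatCoordEquiv L hHa hdet).symm ⟨_, _⟩)
    rw [quatCoord_smul, quatCoord_smul, Matrix.mul_smul, ← coe_quatCoordEquiv L hHa hdet ((quatCoordEquiv L hHa hdet).symm _),
      ContinuousAddEquiv.apply_symm_apply]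

/-- `quatCoord e (T_y a) = y · quatCoord e a`. [cite: VignerasLNM800, Ch. III §1] -/
theorem quatCoord_leftMulLin (y : ↥(quatAdelicUnits L Ha)) (a : Fin 4 → AdeleRing (𝓞 ↥(maximalRealSubfield L)) ↥(maximalRealSubfield L)) :
    quatCoord L (fun i => ((quatBasis L Ha hHa hdet i : ↥(quatRatSubalgebra L Ha)) : Matrix (Fin 2) (Fin 2) L)) (leftMulLin L hHa hdet y a) =
      ((y : GL (Fin 2) (AdeleRing (𝓞 L) L)) : Matrix (Fin 2) (Fin 2) (AdeleRing (𝓞 L) L)) *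
        quatCoord L (fun i => ((quatBasis L Ha hHa hdet i : ↥(quatRatSubalgebra L Ha)) : Matrix (Fin 2) (Fin 2) L)) a := by
  change ((quatCoordEquiv L hHa hdet ((quatCoordEquiv L hHa hdet).symm _) : ↥(quatAdelic L Ha)) : Matrix (Fin 2) (Fin 2) (AdeleRing (𝓞 L) L)) = _
  rw [ContinuousAddEquiv.apply_symm_apply]

/-- `T_1 = id`. [folklore] -/
theorem leftMulLin_one : leftMulLin L hHa hdet 1 = LinearMap.id := by
  refine LinearMap.ext fun a => ?_
  apply quatCoord_injective L hHa hdet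
  rw [quatCoord_leftMulLin, OneMemClass.coe_one, Units.val_one, Matrix.one_mul, LinearMap.id_apply]

/-- `T_{y z} = T_y ∘ T_z`. [folklore] -/
theorem leftMulLin_mul (y z : ↥(quatAdelicUnits L Ha)) :
    leftMulLin L hHa hdet (y * z) = (leftMulLin L hHa hdet y).comp (leftMulLin L hHa hdet z) := by
  refine LinearMap.ext fun a => ?_
  apply quatCoord_injective L hHa hdet
  rw [quatCoord_leftMulLin, LinearMap.comp_apply, quatCoord_leftMulLin, quatCoord_leftMulLin, Subgroup.coe_mul, Units.val_mul, Matrix.mul_assoc]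

/-- **The matrix `M(y) ∈ GL₄(𝔸_K)` of left multiplication by `y` in the ROW convention** (`a ᵥ* M(y) = T_y a`): the transpose of `LinearMap.toMatrix' T_y`, with
inverse `M(y⁻¹)`. [cite: VignerasLNM800, Ch. III §1] -/
def leftMulGL (y : ↥(quatAdelicUnits L Ha)) : GL (Fin 4) (AdeleRing (𝓞 ↥(maximalRealSubfield L)) ↥(maximalRealSubfield L)) where
  val := (LinearMap.toMatrix' (leftMulLin L hHa hdet y))ᵀ
  inv := (LinearMap.toMatrix' (leftMulLin L hHa hdet y⁻¹))ᵀ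
  val_inv := by
    rw [← Matrix.transpose_mul, ← LinearMap.toMatrix'_comp, ← leftMulLin_mul, inv_mul_cancel, leftMulLin_one, LinearMap.toMatrix'_id,
      Matrix.transpose_one]
  inv_val := by
    rw [← Matrix.transpose_mul, ← LinearMap.toMatrix'_comp, ← leftMulLin_mul, mul_inv_cancel, leftMulLin_one, LinearMap.toMatrix'_id,
      Matrix.transpose_one]

/-- `a ᵥ* M(y) = T_y a`. [folklore] -/
theorem vecMul_leftMulGL (y : ↥(quatAdelicUnits L Ha)) (a : Fin 4 → AdeleRing (𝓞 ↥(maximalRealSubfield L)) ↥(maximalRealSubfield L)) :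
    a ᵥ* ((leftMulGL L hHa hdet y : GL (Fin 4) (AdeleRing (𝓞 ↥(maximalRealSubfield L)) ↥(maximalRealSubfield L))) :
        Matrix (Fin 4) (Fin 4) (AdeleRing (𝓞 ↥(maximalRealSubfield L)) ↥(maximalRealSubfield L))) =
      leftMulLin L hHa hdet y a := by
  change a ᵥ* (LinearMap.toMatrix' (leftMulLin L hHa hdet y))ᵀ = _
  rw [Matrix.vecMul_transpose, LinearMap.toMatrix'_mulVec]

/-- **`y · quatCoord e (a) = quatCoord e (a ᵥ* M(y))`** — left multiplication in coordinates. [cite: VignerasLNM800, Ch. III §1] -/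
theorem coe_mul_quatCoord_eq (y : ↥(quatAdelicUnits L Ha)) (a : Fin 4 → AdeleRing (𝓞 ↥(maximalRealSubfield L)) ↥(maximalRealSubfield L)) :
    ((y : GL (Fin 2) (AdeleRing (𝓞 L) L)) : Matrix (Fin 2) (Fin 2) (AdeleRing (𝓞 L) L)) *
        quatCoord L (fun i => ((quatBasis L Ha hHa hdet i : ↥(quatRatSubalgebra L Ha)) : Matrix (Fin 2) (Fin 2) L)) a =
      quatCoord L (fun i => ((quatBasis L Ha hHa hdet i : ↥(quatRatSubalgebra L Ha)) : Matrix (Fin 2) (Fin 2) L))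
        (a ᵥ* ((leftMulGL L hHa hdet y : GL (Fin 4) (AdeleRing (𝓞 ↥(maximalRealSubfield L)) ↥(maximalRealSubfield L))) :
          Matrix (Fin 4) (Fin 4) (AdeleRing (𝓞 ↥(maximalRealSubfield L)) ↥(maximalRealSubfield L)))) := by
  rw [vecMul_leftMulGL, quatCoord_leftMulLin]

/-- The entries of `LinearMap.toMatrix' T_y` depend continuously on `y` (each is a coordinate of `quatCoordEquiv⁻¹ (y · (eⱼ ⊗ 1))`). [folklore] -/
theorem continuous_toMatrix'_leftMulLin :
    Continuous fun y : ↥(quatAdelicUnits L Ha) => LinearMap.toMatrix' (leftMulLin L hHa hdet y) := by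
  refine continuous_pi fun i => continuous_pi fun j => ?_
  simp only [LinearMap.toMatrix'_apply]
  change Continuous fun y : ↥(quatAdelicUnits L Ha) => ((quatCoordEquiv L hHa hdet).symm
    ⟨((y : GL (Fin 2) (AdeleRing (𝓞 L) L)) : Matrix (Fin 2) (Fin 2) (AdeleRing (𝓞 L) L)) *
        quatCoord L (fun i => ((quatBasis L Ha hHa hdet i : ↥(quatRatSubalgebra L Ha)) : Matrix (Fin 2) (Fin 2) L)) (Pi.single j 1),
      coe_mul_quatCoord_mem L hHa hdet y _⟩) i
  refine (continuous_apply i).comp ((quatCoordEquiv L hHa hdet).symm.continuous.comp ?_)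
  exact ((Units.continuous_val.comp continuous_subtype_val).mul continuous_const).subtype_mk _

/-- **`y ↦ M(y)` is continuous** into `GL₄(𝔸_K)` (entries of `M(y)` and of `M(y)⁻¹ = M(y⁻¹)` are continuous; Mathlib `Units.continuous_iff`). [folklore] -/
theorem continuous_leftMulGL : Continuous (leftMulGL L hHa hdet) := by
  refine Units.continuous_iff.2 ⟨?_, ?_⟩
  · change Continuous fun y => (LinearMap.toMatrix' (leftMulLin L hHa hdet y))ᵀ
    exact continuous_id.matrix_transpose.comp (continuous_toMatrix'_leftMulLin L hHa hdet)
  · change Continuous fun y => (LinearMap.toMatrix' (leftMulLin L hHa hdet y⁻¹))ᵀ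
    exact continuous_id.matrix_transpose.comp ((continuous_toMatrix'_leftMulLin L hHa hdet).comp continuous_inv)

/-- **EXISTENCE FORM (the statement consumers quote)**: a continuous `M : (D_h ⊗ 𝔸)^× → GL₄(𝔸_K)` with `y · quatCoord e (a) = quatCoord e (a ᵥ* M y)`.
[cite: VignerasLNM800, Ch. III §1] [cite: WeilBNT1967, Ch. VII §5] -/
theorem exists_leftMulGL :
    ∃ M : ↥(quatAdelicUnits L Ha) → GL (Fin 4) (AdeleRing (𝓞 ↥(maximalRealSubfield L)) ↥(maximalRealSubfield L)), Continuous M ∧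
      ∀ (y : ↥(quatAdelicUnits L Ha)) (a : Fin 4 → AdeleRing (𝓞 ↥(maximalRealSubfield L)) ↥(maximalRealSubfield L)),
        ((y : GL (Fin 2) (AdeleRing (𝓞 L) L)) : Matrix (Fin 2) (Fin 2) (AdeleRing (𝓞 L) L)) *
            quatCoord L (fun i => ((quatBasis L Ha hHa hdet i : ↥(quatRatSubalgebra L Ha)) : Matrix (Fin 2) (Fin 2) L)) a =
          quatCoord L (fun i => ((quatBasis L Ha hHa hdet i : ↥(quatRatSubalgebra L Ha)) : Matrix (Fin 2) (Fin 2) L))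
            (a ᵥ* ((M y : GL (Fin 4) _) : Matrix (Fin 4) (Fin 4) (AdeleRing (𝓞 ↥(maximalRealSubfield L)) ↥(maximalRealSubfield L)))) :=
  ⟨leftMulGL L hHa hdet, continuous_leftMulGL L hHa hdet, coe_mul_quatCoord_eq L hHa hdet⟩

end LeftMul

/-! ## §2 The central ray `θ_τ` in coordinates -/

section Ray

/-- **The central section acts on coordinates by the scalar idèle `posRealIdele K (τ^{1∕4d})`**:
`θ_τ · quatCoord e (a) = quatCoord e (posRealIdele K (τ^{1∕4d}) • a)` (★ `coe_baseScalar`, ★ `quatCoord_smul`). [cite: WeilBNT1967, Ch. IV §4] [cite: VignerasLNM800, Ch. III §2] -/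
theorem coe_quatModuleSection_mul_quatCoord (τ : ℝ≥0ˣ) (a : Fin 4 → AdeleRing (𝓞 ↥(maximalRealSubfield L)) ↥(maximalRealSubfield L)) :
    (((quatModuleSection L Ha τ : ↥(quatAdelicUnits L Ha)) : GL (Fin 2) (AdeleRing (𝓞 L) L)) : Matrix (Fin 2) (Fin 2) (AdeleRing (𝓞 L) L)) *
        quatCoord L (fun i => ((quatBasis L Ha hHa hdet i : ↥(quatRatSubalgebra L Ha)) : Matrix (Fin 2) (Fin 2) L)) a =
      quatCoord L (fun i => ((quatBasis L Ha hHa hdet i : ↥(quatRatSubalgebra L Ha)) : Matrix (Fin 2) (Fin 2) L))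
        (((posRealIdele ↥(maximalRealSubfield L)
            (Units.map (NNReal.rpowMonoidHom ((4 * Module.finrank ℚ ↥(maximalRealSubfield L) : ℕ) : ℝ)⁻¹) τ) :
              (AdeleRing (𝓞 ↥(maximalRealSubfield L)) ↥(maximalRealSubfield L))ˣ) :
            AdeleRing (𝓞 ↥(maximalRealSubfield L)) ↥(maximalRealSubfield L)) • a) := by
  rw [quatModuleSection_apply, coe_baseScalar, Matrix.GeneralLinearGroup.coe_scalar, Matrix.scalar_apply, ← Matrix.smul_eq_diagonal_mul,
    AdeleRing.coe_ideleBaseChange, quatCoord_smul]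

omit [IsCMField L] in
/-- In the row convention a scalar dilation is right multiplication by the scalar matrix: `(c • a) ᵥ* M = (a ᵥ* M) ᵥ* (c · 1) = a ᵥ* (M · z)` with
`z = posRealScalar 4 K s`, `c = posRealIdele K s`. [folklore] -/
theorem smul_vecMul_eq_vecMul_mul_posRealScalar (s : ℝ≥0ˣ) (a : Fin 4 → AdeleRing (𝓞 ↥(maximalRealSubfield L)) ↥(maximalRealSubfield L))
    (M : Matrix (Fin 4) (Fin 4) (AdeleRing (𝓞 ↥(maximalRealSubfield L)) ↥(maximalRealSubfield L))) :
    (((posRealIdele ↥(maximalRealSubfield L) s : (AdeleRing (𝓞 ↥(maximalRealSubfield L)) ↥(maximalRealSubfield L))ˣ) :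
        AdeleRing (𝓞 ↥(maximalRealSubfield L)) ↥(maximalRealSubfield L)) • a) ᵥ* M =
      a ᵥ* (M * ((posRealScalar 4 ↥(maximalRealSubfield L) s : GL (Fin 4) (AdeleRing (𝓞 ↥(maximalRealSubfield L)) ↥(maximalRealSubfield L))) :
        Matrix (Fin 4) (Fin 4) (AdeleRing (𝓞 ↥(maximalRealSubfield L)) ↥(maximalRealSubfield L)))) := by
  rw [Matrix.smul_vecMul, ← Matrix.vecMul_vecMul, posRealScalar, MonoidHom.comp_apply, Matrix.GeneralLinearGroup.coe_scalar, Matrix.scalar_apply,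
    Matrix.vecMul_diagonal_const, op_smul_eq_smul]

end Ray


end Summit.HodgeConjecture.HodgeConjecture.Cruxes.H413.K2E5QuatLeftMul

end
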